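import Literature.NumberTheory.LFunctions.Zhang2022.KnifeEdgeBandScaleFlat
import Literature.NumberTheory.LFunctions.Zhang2022.KnifeEdgeDiscWeightScale
import Literature.NumberTheory.LFunctions.Zhang2022.RepairRplusWallZero

/-!
# Zhang (2022) §18-margin repair rung — barrier extension `R⁺⁺`: the smooth class FROM THE TRUE BAND EDGE
# (`N₁ ≥ D·P·𝓛^{1058+2A}`, saving `𝓛^{−A}`, no fixed `ε`), and its MAIN-SCALE reading via the units lemma

Trunk T-ANT (NumberTheory/LFunctions). Y. Zhang, *Discrete mean estimates and the Landau–Siegel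
zero*, arXiv:2211.02515v1 (2022) [Zhang2022LandauSiegel] — **an unrefereed manuscript under
adjudication. WHAT THIS IS NOT: nothing here asserts or denies its Theorems 1–2 or any analytic lemma;
no claim about Landau–Siegel zeros, about Parity, or about a repaired `Margin232` is made.** Cell `landau-siegel`
(rung F-S3), sub-cell E, seat ls-barrier-p2 g2 (slice «invisible tail beyond `pDt₀`», successor step (3) of the g0 §).

The `R⁺` row `familyFarPiece` (p455670) and the rows `familySmoothLengths`/`familySmoothTop` (p457377) compare lengths
`≥ P^{1+ε}` for a FIXED `ε > 0` (saving `P^{−ε/8}`), leaving the fixed-width band `(1, 1+ε]` to the E-004 slot. With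
the band-scale invisible tail (`KnifeEdgeInvisibleTail.tailInvisible_bandScale`, p469201; `discMeanFlat_bandEdge`,
p469409) the same verdict holds from the TRUE band edge `n ≥ D·P·𝓛^{1058+2A}`, i.e.
`z = log n/log P ≥ 1 + α̃ + (539+2A)·log𝓛/𝓛⁹` (`α̃ = log(Dt₀)/log P`, (2.30)), with saving `𝓛^{−A}` for every `A`:

* `BandEdgeDesign` `d = (c′, g)`, class `LipschitzWith 1 g ∧ ‖g‖∞ ≤ 1` (exactly `familyFarPiece`'s regularity; NO
  wall-value condition, NO top condition); `familyBandEdge` with Verdict: for every `δ > 0`, every `A : ℕ`, for all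
  large `D`, under the displayed (A)-hypothesis `Re ρ = ½` (kind (b)), for every
  `⌈D·P·𝓛^{1058+2A}⌉ + 1 ≤ N₁ ≤ N₂ ≤ ⌈P^{1+δ}⌉`: `¬ (𝓛^{−A}·(discMeanAbs(N₁) + discWeight) < |discMean(N₂) − discMean(N₁)|)`;
  `familyBandEdge_decided` (UNCONDITIONAL apart from (b): no E-004 slot, no fixed `ε`), `rplus_bandEdge_decided`.
* C2: `familyFarPiece` members and `WallZeroDesign` members are members (`inClass_ofFarPiece'`, `inClass_ofWallZero`);
  C4: the flat profile and the triangular overhang (`inClass_const_one`, `inClass_triangle'`).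
* MAIN-SCALE READING `discMeanFlat_bandEdge_mainScale`: granted ALSO Prop. 7.1, Lemma 8.1, Prop. 2.2 (i), Lemma 2.3
  (displayed manuscript nodes; they give `discWeight ≤ 3𝓛⁹𝔓`, `Skeleton.discWeight_trivialScale_window`, p467613),
  under (A): `|discMean(N₂) − discMean(N₁)| ≤ 𝓛^{−A}·discMeanAbs(N₁) + 3·𝓛⁹·𝓛^{−A}·𝔓` — `o(𝔞𝔓)` for `A ≥ 10`
  (`𝔞 ≥ a₀`, `frakALowerBound_holds`): no MAIN-ORDER length gain from the true band edge on. What remains of the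
  E-004 seam for the smooth wall-zero class is the `(1 + o(1))·α̃`-band itself (slot `Repair.DiscMeanBandMain`,
  p466556, now only needed for `w ≍ α̃`, not for a fixed `w`).

CURRENCY (REF-E C3(e)): discrete mean over the sampled zeros; (b) displayed; no (c)-slot in `familyBandEdge`.

## References

* Y. Zhang, arXiv:2211.02515v1 (2022), §2 (2.14)–(2.20), (2.30)–(2.31), §7 Prop 7.1 (7.2), §8 Lemma 8.1.
  [cite: Zhang2022LandauSiegel, §§2, 7, 8]
* H. L. Montgomery, R. C. Vaughan, *Multiplicative Number Theory I*, Thm 9.18. [cite: MontgomeryVaughan2007, Thm 9.18]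
-/

noncomputable section

open Real Complex
open scoped NNReal

namespace Literature.NumberTheory.LFunctions.Zhang2022

namespace Repair

/-! ### The family «smooth profile, from the true band edge to any length ≤ P^{1+δ}» -/

/-- A design of the band-edge family: shift parameter `c′` and the FULL profile `g`.
[cite: Zhang2022LandauSiegel, §2 (2.23); §7 (7.2) p.44] -/
structure BandEdgeDesign where
  /-- the shift parameter `c′` of `𝔠*` -/
  c' : ℝ
  /-- the full profile `g(z)`, `z = log n / log P` -/
  g : ℝ → ℂ

/-- **Class predicate** (regularity only; NO analytic hypothesis, no wall or top condition): `g` globally 1-Lipschitz,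
`‖g‖∞ ≤ 1`. [cite: Zhang2022LandauSiegel, §7 (7.2) p.44] -/
def BandEdgeDesign.InClass (d : BandEdgeDesign) : Prop :=
  LipschitzWith 1 d.g ∧ ∀ z, ‖d.g z‖ ≤ 1

/-- **Verdict** «no length gain beyond `𝓛^{−A}·(discMeanAbs + discWeight)` between ANY two lengths from the true band
edge `⌈D·P·𝓛^{1058+2A}⌉ + 1` up to `⌈P^{1+δ}⌉`», for every `δ > 0` and every `A`, the (A)-hypothesis (kind (b))
DISPLAYED. [cite: Zhang2022LandauSiegel, §2 (2.16)–(2.20), (2.30); §8 Lemma 8.1] -/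
def BandEdgeDesign.Verdict (d : BandEdgeDesign) : Prop :=
  ∀ ⦃δ : ℝ⦄, 0 < δ → ∀ A : ℕ, Skeleton.ForAllLarge fun D _ χ =>
    (∀ i ∈ Skeleton.idx χ, (i.2).re = 1 / 2) →
      ∀ N₁ N₂ : ℕ, ⌈(D : ℝ) * Skeleton.bigP D * Skeleton.ell D ^ (1058 + 2 * A)⌉₊ + 1 ≤ N₁ → N₁ ≤ N₂ →
        N₂ ≤ ⌈Skeleton.bigP D ^ (1 + δ)⌉₊ →
        ¬ ((Skeleton.ell D ^ A)⁻¹ * (discMeanAbs d.c' χ d.g N₁ + discWeight d.c' χ) <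
            |discMean d.c' χ d.g N₂ - discMean d.c' χ d.g N₁|)

/-- **The slice theorem** `∀ d, K d → V d` (band edge; no slot). [cite: Zhang2022LandauSiegel, §2 (2.16)–(2.20); §8 Lemma 8.1] -/
theorem BandEdgeDesign.verdict_of_inClass (d : BandEdgeDesign) (h : d.InClass) : d.Verdict := by
  intro δ hδ A
  refine (KnifeEdgeInvisibleTail.discMeanFlat_bandEdge d.c' hδ A).mono ?_
  intro D _ χ _ _ hflat hA N₁ N₂ hN₁ hN₁₂ hN₂
  exact not_lt.2 (hflat hA d.g h.1 h.2 N₁ N₂ hN₁ hN₁₂ hN₂)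

/-- family «smooth profile of any length, from the TRUE band edge, discrete-mean currency, no slot».
[cite: Zhang2022LandauSiegel, §2 (2.16)–(2.20), (2.30); §8 Lemma 8.1] -/
def familyBandEdge : DesignFamily where
  Design := BandEdgeDesign
  InClass := BandEdgeDesign.InClass
  Verdict := BandEdgeDesign.Verdict

/-- **`familyBandEdge` is decided.** [cite: Zhang2022LandauSiegel, §2 (2.16)–(2.20); §8 Lemma 8.1] -/
theorem familyBandEdge_decided : familyBandEdge.Decided :=
  fun d h => BandEdgeDesign.verdict_of_inClass d h

/-! ### C2 (embeddings) and C4 (witnesses) -/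

/-- C2: a `familyFarPiece` design `(c′, δ, ε, g)` is a band-edge design (same regularity).
[cite: Zhang2022LandauSiegel, §7 (7.2) p.44] -/
theorem inClass_ofFarPiece' {p : ℝ × ℝ × ℝ × (ℝ → ℂ)} (h : familyFarPiece.InClass p) :
    (BandEdgeDesign.mk p.1 p.2.2.2).InClass :=
  ⟨h.2.2.1, h.2.2.2⟩

/-- C2: a wall-value-zero design (p459259) is a band-edge design (drop `g(1) = 0`).
[cite: Zhang2022LandauSiegel, §7 (7.2) p.44] -/
theorem inClass_ofWallZero (d : WallZeroDesign) (h : d.InClass) : (BandEdgeDesign.mk d.c' d.g).InClass :=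
  ⟨h.1, h.2.1⟩

/-- C4: the flat profile `g ≡ 1` is a member. [cite: Zhang2022LandauSiegel, §7 (7.2) p.44] -/
theorem inClass_const_one (c' : ℝ) : (BandEdgeDesign.mk c' fun _ => 1).InClass :=
  ⟨(LipschitzWith.const (1 : ℂ)).weaken zero_le_one, fun _ => by simp⟩

/-- C4: the triangular overhang `max 0 (min (y − 1) (θ − y))`, `1 ≤ θ ≤ 3`, is a member.
[cite: Zhang2022LandauSiegel, §7 (7.2) p.44] -/
theorem inClass_triangle' (c' : ℝ) {θ : ℝ} (hθ : 1 ≤ θ) (hθ3 : θ ≤ 3) :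
    (BandEdgeDesign.mk c' fun y => ((max 0 (min (y - 1) (θ - y)) : ℝ) : ℂ)).InClass :=
  inClass_ofWallZero _ (inClass_triangle c' hθ hθ3)

/-! ### The main-scale reading (units lemma) and the extension step -/

/-- **Band-edge flatness AT THE MAIN SCALE.** Granted Prop. 7.1, Lemma 8.1, Prop. 2.2 (i), Lemma 2.3 (displayed
manuscript nodes, via `Skeleton.discWeight_trivialScale_window`: `discWeight ≤ 3𝓛⁹𝔓`), for all large `D` under (A) and
the displayed `Re ρ = ½`: for every 1-Lipschitz `‖g‖ ≤ 1` and every `⌈D·P·𝓛^{1058+2A}⌉ + 1 ≤ N₁ ≤ N₂ ≤ ⌈P^{1+δ}⌉`,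
`|discMean(N₂) − discMean(N₁)| ≤ 𝓛^{−A}·discMeanAbs(N₁) + 3·𝓛⁹·𝓛^{−A}·𝔓` (`= o(𝔞𝔓)` once `A ≥ 10`).
[cite: Zhang2022LandauSiegel, §2 (2.16), (2.30); §7 Prop 7.1; §8 Lemma 8.1] -/
theorem discMeanFlat_bandEdge_mainScale (c' : ℝ) {δ : ℝ} (hδ : 0 < δ) (A : ℕ)
    (h71 : Skeleton.Prop71 c') (h81 : Skeleton.Lemma81 c') (h22 : Skeleton.Prop22i) (h23 : Skeleton.Lemma23 c') :
    Skeleton.ForAllLarge fun D _ χ => Skeleton.AssumptionA D χ →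
      (∀ i ∈ Skeleton.idx χ, (i.2).re = 1 / 2) →
        ∀ g : ℝ → ℂ, LipschitzWith 1 g → (∀ z, ‖g z‖ ≤ 1) →
          ∀ N₁ N₂ : ℕ, ⌈(D : ℝ) * Skeleton.bigP D * Skeleton.ell D ^ (1058 + 2 * A)⌉₊ + 1 ≤ N₁ → N₁ ≤ N₂ →
            N₂ ≤ ⌈Skeleton.bigP D ^ (1 + δ)⌉₊ →
            |discMean c' χ g N₂ - discMean c' χ g N₁| ≤
              (Skeleton.ell D ^ A)⁻¹ * discMeanAbs c' χ g N₁ +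
                3 * Skeleton.ell D ^ 9 * (Skeleton.ell D ^ A)⁻¹ * frakP D := by
  refine ((KnifeEdgeInvisibleTail.discMeanFlat_bandEdge c' hδ A).and
    ((Skeleton.discWeight_trivialScale_window c' h71 h81 h22 h23).and
      (Skeleton.ForAllLarge.of_le 3 fun D _ _ hD _ _ => hD))).mono ?_
  intro D _ χ _ _ h hA hcrit g hg hg1 N₁ N₂ hN₁ hN₁₂ hN₂
  obtain ⟨hflat, hW, hD3⟩ := h
  have h1 := hflat hcrit g hg hg1 N₁ N₂ hN₁ hN₁₂ hN₂
  have h2 := (hW hA).2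
  have hℓ : 0 ≤ (Skeleton.ell D ^ A)⁻¹ :=
    inv_nonneg.mpr (pow_nonneg (zero_le_one.trans (Skeleton.one_lt_ell hD3).le) A)
  calc |discMean c' χ g N₂ - discMean c' χ g N₁|
      ≤ (Skeleton.ell D ^ A)⁻¹ * (discMeanAbs c' χ g N₁ + discWeight c' χ) := h1
    _ ≤ (Skeleton.ell D ^ A)⁻¹ * (discMeanAbs c' χ g N₁ + 3 * Skeleton.ell D ^ 9 * frakP D) := by gcongr
    _ = _ := by ring

/-- **`R⁺⁺`-step of this file**: `ClassDecided (Rplus ++ [familyBandEdge])`.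
[cite: Zhang2022LandauSiegel, §2 (2.32)–(2.33); §7 (7.2) p.44] -/
theorem rplus_bandEdge_decided : ClassDecided (Rplus ++ [familyBandEdge]) :=
  rplus_extend familyBandEdge_decided

end Repair

end Literature.NumberTheory.LFunctions.Zhang2022

namespace Literature.NumberTheory.LFunctions.Zhang2022

namespace Repair

/-! ### Appended: the band edge lies below every `P^{1+δ}` eventually (the verdicts above are not vacuous)

For fixed `δ > 0` and `m : ℕ`, eventually in `D`: `⌈D·P·𝓛^m⌉ + 1 < ⌈P^{1+δ}⌉` — so the length range
`⌈D·P·𝓛^{1058+2A}⌉ + 1 ≤ N₁ ≤ N₂ ≤ ⌈P^{1+δ}⌉` of `familyBandEdge` (and of the rows of `RepairSmoothBandEdge.lean`)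
contains pairs `N₁ < N₂` for all large `D` (REF-E C4/C6: the verdict quantifies over a non-empty range).
`D·𝓛^m = e^{𝓛}𝓛^m ≤ e^{(m+1)𝓛}` against `P^δ = e^{δ𝓛⁹}`. -/

/-- `L ≤ log D` once `⌈e^L⌉ ≤ D`. [folklore] -/
private theorem le_ell_of_ceil_exp_le₅ {L₀ : ℝ} {D : ℕ} (hD : ⌈Real.exp L₀⌉₊ ≤ D) : L₀ ≤ Skeleton.ell D := by
  have h : Real.exp L₀ ≤ (D : ℝ) := (Nat.le_ceil _).trans (by exact_mod_cast hD)
  exact (Real.le_log_iff_exp_le (lt_of_lt_of_le (Real.exp_pos _) h)).mpr h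

/-- **The band edge is below `P^{1+δ}`:** for `δ > 0`, `m : ℕ`, eventually `D·P·𝓛^m + 2 ≤ P^{1+δ}`.
[cite: Zhang2022LandauSiegel, §2 (2.6), (2.30)] -/
theorem bandEdge_add_two_le_rpow {δ : ℝ} (hδ : 0 < δ) (m : ℕ) :
    Skeleton.ForAllLarge fun D _ _ =>
      (D : ℝ) * Skeleton.bigP D * Skeleton.ell D ^ m + 2 ≤ Skeleton.bigP D ^ (1 + δ) := by
  refine Skeleton.ForAllLarge.of_le ⌈Real.exp (max 1 ((m + 3) / δ))⌉₊ ?_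
  intro D _ χ hD _ _
  have hℓ : max 1 ((m + 3) / δ) ≤ Skeleton.ell D := le_ell_of_ceil_exp_le₅ hD
  have hℓ1 : 1 ≤ Skeleton.ell D := le_trans (le_max_left _ _) hℓ
  have hℓm : (m + 3) / δ ≤ Skeleton.ell D := le_trans (le_max_right _ _) hℓ
  have hℓ0 : 0 < Skeleton.ell D := by linarith
  have hP : 0 < Skeleton.bigP D := Real.exp_pos _
  have hP1 : 1 ≤ Skeleton.bigP D := by rw [Skeleton.bigP]; exact Real.one_le_exp (by positivity)
  have hDpos : (0 : ℝ) < D := by exact_mod_cast Nat.pos_of_ne_zero (NeZero.ne D)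
  have hDexp : (D : ℝ) = Real.exp (Skeleton.ell D) := by rw [Skeleton.ell, Real.exp_log hDpos]
  -- `𝓛^m ≤ e^{m𝓛}` and `2 ≤ e^{𝓛}` hence `D·𝓛^m + 2 ≤ 2e^{(m+1)𝓛} ≤ e^{(m+2)𝓛}`
  have h1 : Skeleton.ell D ≤ Real.exp (Skeleton.ell D) := by
    have := Real.add_one_le_exp (Skeleton.ell D); linarith
  have hm : Skeleton.ell D ^ m ≤ Real.exp (m * Skeleton.ell D) := by
    calc Skeleton.ell D ^ m ≤ Real.exp (Skeleton.ell D) ^ m := pow_le_pow_left₀ hℓ0.le h1 m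
      _ = Real.exp (m * Skeleton.ell D) := by rw [← Real.exp_nat_mul]
  have h2 : (2 : ℝ) ≤ Real.exp (Skeleton.ell D) := by
    have := Real.add_one_le_exp (Skeleton.ell D); linarith
  have hsum : (D : ℝ) * Skeleton.ell D ^ m + 2 ≤ Real.exp ((m + 2) * Skeleton.ell D) := by
    have e1 : (D : ℝ) * Skeleton.ell D ^ m ≤ Real.exp ((m + 1) * Skeleton.ell D) := by
      calc (D : ℝ) * Skeleton.ell D ^ m ≤ Real.exp (Skeleton.ell D) * Real.exp (m * Skeleton.ell D) := by
            rw [hDexp]; exact mul_le_mul_of_nonneg_left hm (Real.exp_pos _).le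
        _ = Real.exp ((m + 1) * Skeleton.ell D) := by rw [← Real.exp_add]; ring_nf
    have e2 : (2 : ℝ) ≤ Real.exp ((m + 1) * Skeleton.ell D) := by
      refine h2.trans (Real.exp_le_exp.mpr ?_)
      have : 0 ≤ (m : ℝ) * Skeleton.ell D := by positivity
      linarith
    have e3 : 2 * Real.exp ((m + 1) * Skeleton.ell D) ≤ Real.exp ((m + 2) * Skeleton.ell D) := by
      calc 2 * Real.exp ((m + 1) * Skeleton.ell D)
          ≤ Real.exp (Skeleton.ell D) * Real.exp ((m + 1) * Skeleton.ell D) :=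
            mul_le_mul_of_nonneg_right h2 (Real.exp_pos _).le
        _ = Real.exp ((m + 2) * Skeleton.ell D) := by rw [← Real.exp_add]; ring_nf
    linarith
  -- `(m+2)𝓛 ≤ δ𝓛⁹` once `𝓛⁸ ≥ 𝓛 ≥ (m+3)/δ`
  have hkey : (m + 2) * Skeleton.ell D ≤ δ * Skeleton.ell D ^ 9 := by
    have h8 : Skeleton.ell D ≤ Skeleton.ell D ^ 8 := by
      calc Skeleton.ell D = Skeleton.ell D ^ 1 := (pow_one _).symm
        _ ≤ Skeleton.ell D ^ 8 := pow_le_pow_right₀ hℓ1 (by norm_num)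
    have hm3 : (m : ℝ) + 3 ≤ δ * Skeleton.ell D := by rwa [div_le_iff₀' hδ] at hℓm
    have hm2 : (m : ℝ) + 2 ≤ δ * Skeleton.ell D ^ 8 := by nlinarith
    calc (m + 2) * Skeleton.ell D ≤ δ * Skeleton.ell D ^ 8 * Skeleton.ell D :=
          mul_le_mul_of_nonneg_right hm2 hℓ0.le
      _ = δ * Skeleton.ell D ^ 9 := by ring
  have hPδ : Real.exp ((m + 2) * Skeleton.ell D) ≤ Skeleton.bigP D ^ δ := by
    calc Real.exp ((m + 2) * Skeleton.ell D) ≤ Real.exp (δ * Skeleton.ell D ^ 9) := Real.exp_le_exp.mpr hkey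
      _ = Skeleton.bigP D ^ δ := by rw [Skeleton.bigP, ← Real.exp_mul]; ring_nf
  calc (D : ℝ) * Skeleton.bigP D * Skeleton.ell D ^ m + 2
      ≤ Skeleton.bigP D * ((D : ℝ) * Skeleton.ell D ^ m + 2) := by nlinarith
    _ ≤ Skeleton.bigP D * Skeleton.bigP D ^ δ := mul_le_mul_of_nonneg_left (hsum.trans hPδ) hP.le
    _ = Skeleton.bigP D ^ (1 + δ) := by rw [Real.rpow_add hP, Real.rpow_one]

/-- **Non-vacuity of the band-edge range:** for `δ > 0`, `m : ℕ`, eventually `⌈D·P·𝓛^m⌉ + 1 < ⌈P^{1+δ}⌉`, so the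
verdict of `familyBandEdge` quantifies over pairs `N₁ < N₂` for all large `D`. [cite: Zhang2022LandauSiegel, §2 (2.6), (2.30)] -/
theorem bandEdge_lt_ceil_rpow {δ : ℝ} (hδ : 0 < δ) (m : ℕ) :
    Skeleton.ForAllLarge fun D _ _ =>
      ⌈(D : ℝ) * Skeleton.bigP D * Skeleton.ell D ^ m⌉₊ + 1 < ⌈Skeleton.bigP D ^ (1 + δ)⌉₊ := by
  refine (bandEdge_add_two_le_rpow hδ m).mono ?_
  intro D _ χ _ _ h
  have hx0 : 0 ≤ (D : ℝ) * Skeleton.bigP D * Skeleton.ell D ^ m := by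
    have := (Real.exp_pos (Skeleton.ell D ^ 9)).le
    have hD0 : (0 : ℝ) ≤ D := Nat.cast_nonneg D
    have hℓ : 0 ≤ Skeleton.ell D ^ m := by
      rcases Nat.eq_zero_or_pos D with h0 | h0
      · simp [Skeleton.ell, h0]
      · exact pow_nonneg (Real.log_nonneg (by exact_mod_cast h0)) m
    exact mul_nonneg (mul_nonneg hD0 this) hℓ
  have h1 : ((⌈(D : ℝ) * Skeleton.bigP D * Skeleton.ell D ^ m⌉₊ + 1 : ℕ) : ℝ) <
      Skeleton.bigP D ^ (1 + δ) := by
    push_cast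
    have := Nat.ceil_lt_add_one hx0
    linarith
  exact_mod_cast lt_of_lt_of_le h1 (Nat.le_ceil _) |>.trans_le le_rfl

end Repair

end Literature.NumberTheory.LFunctions.Zhang2022
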